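/-
Copyright: statement-level skeleton of a published paper (lit-balaban cell, Phase-2 proof seat p37 gen 108). No claims beyond
what the kernel checks below.
-/
import Mathlib
import Literature.MathematicalPhysics.QuantumFieldTheory.Balaban1983to89.B3GraphGlueAmplitude
import Literature.MathematicalPhysics.QuantumFieldTheory.Balaban1983to89.B3OnePIChainGlue
import Literature.MathematicalPhysics.QuantumFieldTheory.Balaban1983to89.B3Eq121OnePIChainsLetters

/-!
# B3 — T. Bałaban, *(Higgs)₂,₃ quantum fields in a finite volume. III. Renormalization*, CMP **88** (1983) 411–445
[Balaban1983Higgs3], p. 416 [PDF 6], display **(1.21)**: **the AMPUTATED TWO-POINT KERNEL of a two-leg insertion of p18's model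
(p26's evaluator with δ external fields in the two channel legs) and the theorem that the kernel of p37's CHAIN of insertions
`B3OnePIChainGlue.chain T l` glued by propagator lines `C` is the matrix product `K_T · C · K_{l₁} · C ⋯ C · K_{l_r}` — p32's
`B3Eq121OnePIChains.chainAmp` read on graphs** (FILE K3 of the cutting rule; FILE K1 `B3PairingLineCalculus`, FILE K2
`B3GraphGlueAmplitude`)

statement-level skeleton of published theorems with citation tags; proofs where landed; nothing here is a claim about
the Yang–Mills mass gap

PDF held: `paper:balaban1983-higgs-2-3-quantum-fields-finite-volume` (journal page = PDF page + 410); p. 416 read on the ×2 render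
`run/shared/lean/pub/pub-balaban/b2b-balaban-ref1/pages/1983-cmp88-higgs23-III/…-p006-x2.png`.

CITATION HEADER (lean-in-tree rule).  lit-balaban TYPED SKELETON (HOME `run/shared/lean/pub/lit-balaban/`), PHASE 2, seat p37 gen 108
(unit `lit-balaban-p37`; TAKING (K), HOME/STATUS.md 2026-08-23T12:42:19Z, free-target protocol G.5-34(d)); row **B3.Eq1.19-1.22** of
`HOME/lit-balaban-r15/ROWS-B3.md` ((1.21) p. 416; fold owner r15; head `proved` under the lead's HEAD WORD Q25, reading (P) — this file
is an OPTIONAL located member of its (1.21) cell, zero head weight).  It answers, on p18's model, p32 gen 41's HONEST SCOPE (i) of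
`B3Eq121OnePIChains` (p358597): *"instantiating `ι` with such graphs would need their amputated kernels as a function on graphs, which
the tree does not have"* — the function is `Dressing.kernel` below, and `chainAmp` of it IS the value of the glued chain graph
(`chainAmp_eq_kernel_chain`).  CONSUMES BY NAME, nothing re-declared: p37's `B3OnePIChainGlue.TwoLegGraph/glue2/chain` (p363250),
`B3GraphGlue.glue` (p362777), `B3GraphGlueLegs.legL/legR` (p362350); p26's `B3GraphAmplitude.amp` & Co. (p361338); FILE K2
`B3GraphGlueAmplitude` (`sleg`, `flegL/flegR`, `glueRules/gluePo/glueKs/glueKv/glueKo`, `extL/extR/extVL/extVR/extOL/extOR`,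
**`amp_glue`**); p32's `B3Eq121OnePIChains.chainAmp/insAmp/chainDeg/sigmaSeries/greenSeries` (p358597) and
`B3Eq121OnePIChainsLetters.sigmaSeries_eq_greenSeries_of_equiv/eq121_sigmaSeries_of_equiv` (p359170); r15's `B3Sect1TwoPoint.Eq121`.

THE PRINTED TEXT (verbatim), p. 416 [PDF 6]: *"The function G^ε has a perturbative expansion of the following structure
G^ε = Σ_{n=0}^{∞} C^ε_0[(−δm² + Σ^ε + ∂^{ε*}Σ^ε_1 + Σ^{ε*}_1∂^ε + ∂^{ε*}Σ^ε_2∂^ε)C^ε_0]ⁿ, (1.21) where C^ε_0 = (−Δ^ε_0 + m²)^{−1} and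
Σ^ε, Σ^ε_1, Σ^ε_2 are given by amputated, one-particle-irreducible graphs of the expansion of G^ε."*

WHAT IS TYPED / PROVED (definitions with bodies + theorems; no `Prop` fact, no `sorry`; standard axioms).
§1 `sIn/sOut` (the channel φ′-legs of a `TwoLegGraph`), `extIn/extOut`, `sIn_ne_sOut`, `Rest` (its other external φ′-legs),
`sleg_legL/sleg_legR`, `sIn_glue2/sOut_glue2`, `extIn_glue2/extOut_glue2` (the channel legs of `glue2 T₁ T₂` are those of `T₁`, `T₂`),
`restL/restR` (+ `_val`).  §2 `Dressing` (the
evaluator's data of an insertion: vertex rules, (1.18) output pairing, line kernels, and the external data of its NON-channel legs),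
`Dressing.legAmp`, **`Dressing.kernel`** = the AMPUTATED two-point kernel `K_T(p,q) = E(T)[in ↦ δ_p, out ↦ δ_q]` as a `Matrix IS IS ℝ`
(amputated: p26's `amp` puts the external FIELD, not a propagator, in an external leg, so a δ field exposes the bare index),
`glueDressing` (the dressing of `glue2 T₁ T₂` with the joining line's kernel `C`), **`kernel_glue2`**: `K_{glue2 T₁ T₂} = K_{T₁} · C · K_{T₂}`
(from FILE K2's `amp_glue`).  §3 `Dressed`, `chainDressing` (the dressing of `chain T l` from dressings of the letters; `_nil`, `_cons`), **`kernel_chain`**: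
`K_{chain T l} = K_T · Π_i (C · K_{l_i})` (displayed case `kernel_chain_pic1_pic1`: ①—C₀^ε—① of (1.22) has kernel K_①·C₀·K_①), and the bridge to p32's series file **`chainAmp_eq_kernel_chain`**:
`chainAmp C (kernel) (⟨T,D⟩ :: l) = C · K_{chain T l} · C` in `Matrix IS IS ℝ` — the term of (1.21) indexed by the list of
insertions IS the free propagator · (the amputated kernel of the glued chain GRAPH of p18's model) · the free propagator.  §4 (1.21)
ON THE MODEL: for a family `letter : κ → Dressed …` the terms (bare `C₀` ⊕ chain graphs, `chainIndexEquiv`) with values `chainValue`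
and orders `chainOrder` have generating series = p32's `greenSeries` (**`sigmaSeries_chainValue_eq_greenSeries`**) and satisfy r15's
resummed (1.21) `Eq121` with `X` = the series of the letters' amputated kernels (**`eq121_chainValue`**, p32's transport theorem
`B3Eq121OnePIChainsLetters.eq121_sigmaSeries_of_equiv` instantiated).
HONEST SCOPE.  (a) The letters are arbitrary two-leg insertions with arbitrary dressings; that the letters of (1.21) are the 1PI
(proper) graphs and `−δm²` vertices is the INDEXING of p32's series (`B3Eq121OnePIChains`, `…Letters`) and p37/p32's chain
structure files (`B3OnePIGraphs`, `B3OnePIChainDecomposition`, …) — the factorization proved here holds for every chain.  (b) The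
joining lines all carry the same kernel `C` (print: `C^ε_0`); letter-dependent joining kernels would be the same proof.  (c) External
data of the non-channel legs multiply across letters (FILE K2 (c)).  (d) Index form only; no convergence, no estimate; the
identification of `C` with `(−Δ^ε_0 + m²)^{−1}` and of the kernels with the concrete (1.19) is p32/p33/p39's lane.  Unit
`lit-balaban-p37` gen 108 (literature-prover-lit-balaban-p37-g108-0), HOME `run/shared/lean/pub/lit-balaban/`, 2026-08-23.
-/

open Finset
open scoped BigOperators

namespace Literature.MathematicalPhysics.QuantumFieldTheory.Balaban1983to89.B3OnePIChainAmplitude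

open B3Prop1 B3Cor23Concrete B3GraphGlueLegs B3GraphGlue B3GraphAmplitude B3PairingLineCalculus B3GraphGlueAmplitude
  B3OnePIChainGlue

variable {nbar : ℕ}

/-! ## §1 The channel legs of a two-leg insertion and of a glued pair -/

section Channel

/-- The in-leg of the channel as a φ′-leg. [cite: Balaban1983Higgs3, (1.21) p.416] -/
abbrev sIn (T : TwoLegGraph nbar) : SLeg T.G.kind := sleg T.legIn T.in_scalar

/-- The out-leg of the channel as a φ′-leg. [cite: Balaban1983Higgs3, (1.21) p.416] -/
abbrev sOut (T : TwoLegGraph nbar) : SLeg T.G.kind := sleg T.legOut T.out_scalar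

/-- The in-leg of the channel as an EXTERNAL φ′-leg of p26's scalar pairing. [cite: Balaban1983Higgs3, (1.21) p.416] -/
abbrev extIn (T : TwoLegGraph nbar) : ExtSLeg T.G := ⟨sIn T, spartner_sleg T.in_ext T.in_scalar⟩

/-- The out-leg of the channel as an external φ′-leg. [cite: Balaban1983Higgs3, (1.21) p.416] -/
abbrev extOut (T : TwoLegGraph nbar) : ExtSLeg T.G := ⟨sOut T, spartner_sleg T.out_ext T.out_scalar⟩

/-- kernel: the two channel legs are distinct φ′-legs. [cite: Balaban1983Higgs3, (1.21) p.416] -/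
theorem sIn_ne_sOut (T : TwoLegGraph nbar) : sIn T ≠ sOut T := fun h =>
  T.in_ne_out (by rw [← toLeg_sleg T.legIn T.in_scalar, ← toLeg_sleg T.legOut T.out_scalar]; exact congrArg SLeg.toLeg h)

/-- The NON-CHANNEL external φ′-legs of an insertion (none for the 1PI graphs of (1.21), p. 417 *"graphs with two external legs of
scalar fields"*; kept general). [cite: Balaban1983Higgs3, (1.21) p.416] -/
abbrev Rest (T : TwoLegGraph nbar) : Type := {x : ExtSLeg T.G // x.1 ≠ sIn T ∧ x.1 ≠ sOut T}

variable {n₁ n₂ : ℕ} (k₁ : Fin n₁ → VertexKind) (k₂ : Fin n₂ → VertexKind)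

/-- kernel: the φ′-leg of an embedded scalar leg (first side). [cite: Balaban1983Higgs3, (1.17) p.415] -/
theorem sleg_legL (x : Leg k₁) (h : (legL k₁ k₂ x).2.isLeft = true) (h' : x.2.isLeft = true) :
    sleg (legL k₁ k₂ x) h = flegL VertexKind.scalarLegs k₁ k₂ (sleg x h') := by
  obtain ⟨i, s⟩ := x
  rcases s with j | j
  · rfl
  · simp at h'

/-- kernel: the φ′-leg of an embedded scalar leg (second side). [cite: Balaban1983Higgs3, (1.17) p.415] -/
theorem sleg_legR (y : Leg k₂) (h : (legR k₁ k₂ y).2.isLeft = true) (h' : y.2.isLeft = true) :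
    sleg (legR k₁ k₂ y) h = flegR VertexKind.scalarLegs k₁ k₂ (sleg y h') := by
  obtain ⟨i, s⟩ := y
  rcases s with j | j
  · rfl
  · simp at h'

variable (T₁ T₂ : TwoLegGraph nbar)

/-- kernel: the in-leg of `glue2 T₁ T₂` is the in-leg of `T₁`, embedded. [cite: Balaban1983Higgs3, (1.21) p.416] -/
theorem sIn_glue2 : sIn (glue2 T₁ T₂) = flegL VertexKind.scalarLegs T₁.G.kind T₂.G.kind (sIn T₁) :=
  sleg_legL _ _ _ _ _

/-- kernel: the out-leg of `glue2 T₁ T₂` is the out-leg of `T₂`, embedded. [cite: Balaban1983Higgs3, (1.21) p.416] -/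
theorem sOut_glue2 : sOut (glue2 T₁ T₂) = flegR VertexKind.scalarLegs T₁.G.kind T₂.G.kind (sOut T₂) :=
  sleg_legR _ _ _ _ _

/-- kernel: the in-leg of `glue2 T₁ T₂` as an external leg is FILE K2's embedding of the in-leg of `T₁`.
[cite: Balaban1983Higgs3, (1.21) p.416] -/
theorem extIn_glue2 : extIn (glue2 T₁ T₂) =
    extL (G₁ := T₁.G) (G₂ := T₂.G) (ha := T₁.out_ext) (hb := T₂.in_ext) (hab := out_isLeft_eq_in_isLeft T₁ T₂)
      T₁.out_scalar T₂.in_scalar ⟨extIn T₁, sIn_ne_sOut T₁⟩ :=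
  Subtype.ext (sIn_glue2 T₁ T₂)

/-- kernel: the out-leg of `glue2 T₁ T₂` as an external leg is FILE K2's embedding of the out-leg of `T₂`.
[cite: Balaban1983Higgs3, (1.21) p.416] -/
theorem extOut_glue2 : extOut (glue2 T₁ T₂) =
    extR (G₁ := T₁.G) (G₂ := T₂.G) (ha := T₁.out_ext) (hb := T₂.in_ext) (hab := out_isLeft_eq_in_isLeft T₁ T₂)
      T₁.out_scalar T₂.in_scalar ⟨extOut T₂, (sIn_ne_sOut T₂).symm⟩ :=
  Subtype.ext (sOut_glue2 T₁ T₂)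

/-- The non-channel external legs of `T₁` inside `glue2 T₁ T₂`. [cite: Balaban1983Higgs3, (1.21) p.416] -/
def restL (x : Rest T₁) : Rest (glue2 T₁ T₂) :=
  ⟨extL (G₁ := T₁.G) (G₂ := T₂.G) (ha := T₁.out_ext) (hb := T₂.in_ext) (hab := out_isLeft_eq_in_isLeft T₁ T₂)
      T₁.out_scalar T₂.in_scalar ⟨x.1, x.2.2⟩, by
    constructor
    · rw [sIn_glue2]
      exact fun h => x.2.1 (flegL_injective _ _ _ h)
    · rw [sOut_glue2]
      exact flegL_ne_flegR _ _ _ _ _⟩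

/-- The non-channel external legs of `T₂` inside `glue2 T₁ T₂`. [cite: Balaban1983Higgs3, (1.21) p.416] -/
def restR (y : Rest T₂) : Rest (glue2 T₁ T₂) :=
  ⟨extR (G₁ := T₁.G) (G₂ := T₂.G) (ha := T₁.out_ext) (hb := T₂.in_ext) (hab := out_isLeft_eq_in_isLeft T₁ T₂)
      T₁.out_scalar T₂.in_scalar ⟨y.1, y.2.1⟩, by
    constructor
    · rw [sIn_glue2]
      exact fun h => flegL_ne_flegR _ _ _ _ _ h.symm
    · rw [sOut_glue2]
      exact fun h => y.2.2 (flegR_injective _ _ _ h)⟩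

/-- kernel: the underlying external leg of `restL`. [cite: Balaban1983Higgs3, (1.21) p.416] -/
@[simp] theorem restL_val (x : Rest T₁) : (restL T₁ T₂ x).1 =
    extL (G₁ := T₁.G) (G₂ := T₂.G) (ha := T₁.out_ext) (hb := T₂.in_ext) (hab := out_isLeft_eq_in_isLeft T₁ T₂)
      T₁.out_scalar T₂.in_scalar ⟨x.1, x.2.2⟩ := rfl

/-- kernel: the underlying external leg of `restR`. [cite: Balaban1983Higgs3, (1.21) p.416] -/
@[simp] theorem restR_val (y : Rest T₂) : (restR T₁ T₂ y).1 =
    extR (G₁ := T₁.G) (G₂ := T₂.G) (ha := T₁.out_ext) (hb := T₂.in_ext) (hab := out_isLeft_eq_in_isLeft T₁ T₂)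
      T₁.out_scalar T₂.in_scalar ⟨y.1, y.2.1⟩ := rfl

end Channel

/-! ## §2 Dressings; the amputated two-point kernel; the kernel of a glued pair -/

section Kernel

variable (SF VF OF IS IV IO : Type*)

/-- A DRESSING of a two-leg insertion: everything p26's evaluator needs besides the graph — the vertex rules, the (1.18) output
pairing, the kernels of its internal lines and output pairs, and the external data of its NON-channel legs (extra φ′-legs, A′-legs,
unpaired outputs). [cite: Balaban1983Higgs3, p.420] -/
structure Dressing (T : TwoLegGraph nbar) where
  /-- the vertex rules (1.6)–(1.15) of the insertion's vertices -/
  V : Rules T.G SF VF OF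
  /-- the (1.18) output pairing -/
  Po : OutPairing T.G
  /-- the kernels of the internal scalar lines -/
  Ks : SLine T.G → IS → IS → ℝ
  /-- the kernels of the internal vector lines -/
  Kv : VLine T.G → IV → IV → ℝ
  /-- the kernels of the output pairs -/
  Ko : Po.Line oRank → IO → IO → ℝ
  /-- the external function of the non-channel φ′-legs -/
  F : (Rest T → IS) → ℝ
  /-- the external function of the A′-legs -/
  A : (ExtVLeg T.G → IV) → ℝ
  /-- the external function of the unpaired outputs -/
  Ψ : (Po.Ext → IO) → ℝ

variable {SF VF OF IS IV IO} [Fintype IS] [Fintype IV] [Fintype IO] (bS : IS → SF) (bV : IV → VF) (bO : IO → OF)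

/-- The expression of the dressed insertion for a given external function of ALL its φ′-legs (p26's `amp` with the dressing's
other data). [cite: Balaban1983Higgs3, p.420] -/
def Dressing.legAmp {T : TwoLegGraph nbar} (D : Dressing SF VF OF IS IV IO T) (Φ : (ExtSLeg T.G → IS) → ℝ) : ℝ :=
  amp D.V bS bV bO D.Po D.Ks D.Kv D.Ko Φ D.A D.Ψ

/-- kernel: `legAmp` depends on the external function only through its values. [cite: Balaban1983Higgs3, p.419] -/
theorem Dressing.legAmp_congr {T : TwoLegGraph nbar} (D : Dressing SF VF OF IS IV IO T) {Φ Φ' : (ExtSLeg T.G → IS) → ℝ}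
    (h : ∀ γ, Φ γ = Φ' γ) : D.legAmp bS bV bO Φ = D.legAmp bS bV bO Φ' := by
  rw [show Φ = Φ' from funext h]

variable [DecidableEq IS]

/-- **The AMPUTATED TWO-POINT KERNEL of a dressed insertion**: `K_T(p,q) = E(T)[in ↦ δ_p, out ↦ δ_q]` — p26's expression with the
external φ′-function that fixes the index of the in-leg to `p` and of the out-leg to `q` (no propagator on the channel legs: the
kernel is amputated, as the Σ's of (1.21)). [cite: Balaban1983Higgs3, (1.21) p.416] -/
def Dressing.kernel {T : TwoLegGraph nbar} (D : Dressing SF VF OF IS IV IO T) : Matrix IS IS ℝ :=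
  Matrix.of fun p q => D.legAmp bS bV bO fun γ =>
    (if γ (extIn T) = p then (1 : ℝ) else 0) * (if γ (extOut T) = q then (1 : ℝ) else 0) * D.F (fun x => γ x.1)

variable (T₁ T₂ : TwoLegGraph nbar)

/-- **The dressing of the glued pair `glue2 T₁ T₂`** from dressings of the pieces and the kernel `C` of the joining line (FILE K2's
glued rules / output pairing / line kernels; the non-channel external data multiply). [cite: Balaban1983Higgs3, (1.21) p.416] -/
def glueDressing (D₁ : Dressing SF VF OF IS IV IO T₁) (D₂ : Dressing SF VF OF IS IV IO T₂) (C : IS → IS → ℝ) :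
    Dressing SF VF OF IS IV IO (glue2 T₁ T₂) where
  V := glueRules (G₁ := T₁.G) (G₂ := T₂.G) (a := T₁.legOut) (b := T₂.legIn) (ha := T₁.out_ext) (hb := T₂.in_ext)
    (hab := out_isLeft_eq_in_isLeft T₁ T₂) D₁.V D₂.V
  Po := gluePo (G₁ := T₁.G) (G₂ := T₂.G) (a := T₁.legOut) (b := T₂.legIn) (ha := T₁.out_ext) (hb := T₂.in_ext)
    (hab := out_isLeft_eq_in_isLeft T₁ T₂) D₁.Po D₂.Po
  Ks := glueKs (G₁ := T₁.G) (G₂ := T₂.G) (a := T₁.legOut) (b := T₂.legIn) (ha := T₁.out_ext) (hb := T₂.in_ext)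
    (hab := out_isLeft_eq_in_isLeft T₁ T₂) D₁.Ks D₂.Ks C
  Kv := glueKv (G₁ := T₁.G) (G₂ := T₂.G) (a := T₁.legOut) (b := T₂.legIn) (ha := T₁.out_ext) (hb := T₂.in_ext)
    (hab := out_isLeft_eq_in_isLeft T₁ T₂) D₁.Kv D₂.Kv
  Ko := glueKo (G₁ := T₁.G) (G₂ := T₂.G) (a := T₁.legOut) (b := T₂.legIn) (ha := T₁.out_ext) (hb := T₂.in_ext)
    (hab := out_isLeft_eq_in_isLeft T₁ T₂) D₁.Po D₂.Po D₁.Ko D₂.Ko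
  F γ := D₁.F (fun x => γ (restL T₁ T₂ x)) * D₂.F (fun y => γ (restR T₁ T₂ y))
  A ζ := D₁.A (fun x => ζ (extVL (G₁ := T₁.G) (G₂ := T₂.G) (ha := T₁.out_ext) (hb := T₂.in_ext)
      (hab := out_isLeft_eq_in_isLeft T₁ T₂) T₁.out_scalar T₂.in_scalar x)) *
    D₂.A (fun y => ζ (extVR (G₁ := T₁.G) (G₂ := T₂.G) (ha := T₁.out_ext) (hb := T₂.in_ext)
      (hab := out_isLeft_eq_in_isLeft T₁ T₂) T₁.out_scalar T₂.in_scalar y))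
  Ψ ξ := D₁.Ψ (fun x => ξ (extOL (G₁ := T₁.G) (G₂ := T₂.G) (ha := T₁.out_ext) (hb := T₂.in_ext)
      (hab := out_isLeft_eq_in_isLeft T₁ T₂) D₁.Po D₂.Po x)) *
    D₂.Ψ (fun y => ξ (extOR (G₁ := T₁.G) (G₂ := T₂.G) (ha := T₁.out_ext) (hb := T₂.in_ext)
      (hab := out_isLeft_eq_in_isLeft T₁ T₂) D₁.Po D₂.Po y))

omit [Fintype IV] [Fintype IO] [DecidableEq IS] in
/-- kernel: the double Kronecker sum `Σ_{p′,q′} C p′ q′ ([p′ = …]…)([q′ = …]…)` reorganised as a matrix triple product entry. [folklore] -/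
private theorem sum_sum_eq_mul_mul (C K₁ K₂ : IS → IS → ℝ) (p q : IS) :
    ∑ p', ∑ q', C p' q' * (K₁ p p' * K₂ q' q) = ∑ q', (∑ p', K₁ p p' * C p' q') * K₂ q' q := by
  calc ∑ p', ∑ q', C p' q' * (K₁ p p' * K₂ q' q) = ∑ p', ∑ q', K₁ p p' * C p' q' * K₂ q' q :=
        Finset.sum_congr rfl fun p' _ => Finset.sum_congr rfl fun q' _ => by ring
    _ = ∑ q', ∑ p', K₁ p p' * C p' q' * K₂ q' q := Finset.sum_comm
    _ = ∑ q', (∑ p', K₁ p p' * C p' q') * K₂ q' q := Finset.sum_congr rfl fun q' _ => (Finset.sum_mul _ _ _).symm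

-- heartbeats: unifying the glued dressing with FILE K2's `amp_glue` statement unfolds `glue2` / `glueDressing` field by field
-- (≈ 3·10⁵ heartbeats measured); no search is involved.
set_option maxHeartbeats 400000 in
/-- **The kernel of a glued pair is the product of the kernels with the joining line's kernel in between**:
`K_{glue2 T₁ T₂} = K_{T₁} · C · K_{T₂}` — the cutting rule of FILE K2 for the channel: cut the joining line, expose the out-leg of
`T₁` (index `p′`) and the in-leg of `T₂` (index `q′`), contract with `C p′ q′`. [cite: Balaban1983Higgs3, (1.21) p.416] -/
theorem kernel_glue2 (D₁ : Dressing SF VF OF IS IV IO T₁) (D₂ : Dressing SF VF OF IS IV IO T₂) (C : IS → IS → ℝ) :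
    (glueDressing T₁ T₂ D₁ D₂ C).kernel bS bV bO = D₁.kernel bS bV bO * Matrix.of C * D₂.kernel bS bV bO := by
  ext p q
  simp only [Matrix.mul_apply, Matrix.of_apply]
  rw [← sum_sum_eq_mul_mul C (D₁.kernel bS bV bO) (D₂.kernel bS bV bO) p q]
  simp only [Dressing.kernel, Matrix.of_apply]
  -- the cutting rule of FILE K2, for the channel's external function
  have h := amp_glue (G₁ := T₁.G) (G₂ := T₂.G) (a := T₁.legOut) (b := T₂.legIn) (ha := T₁.out_ext) (hb := T₂.in_ext)
    (hab := out_isLeft_eq_in_isLeft T₁ T₂) T₁.out_scalar T₂.in_scalar D₁.V D₂.V bS bV bO D₁.Po D₂.Po D₁.Ks D₂.Ks C D₁.Kv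
    D₂.Kv D₁.Ko D₂.Ko
    (fun γ => (if γ (extIn (glue2 T₁ T₂)) = p then (1 : ℝ) else 0) * (if γ (extOut (glue2 T₁ T₂)) = q then (1 : ℝ) else 0) *
      (glueDressing T₁ T₂ D₁ D₂ C).F (fun x => γ x.1))
    (glueDressing T₁ T₂ D₁ D₂ C).A (glueDressing T₁ T₂ D₁ D₂ C).Ψ
    (fun g => (if g ⟨extIn T₁, sIn_ne_sOut T₁⟩ = p then (1 : ℝ) else 0) * D₁.F (fun x => g ⟨x.1, x.2.2⟩))
    (fun g => (if g ⟨extOut T₂, (sIn_ne_sOut T₂).symm⟩ = q then (1 : ℝ) else 0) * D₂.F (fun y => g ⟨y.1, y.2.1⟩))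
    D₁.A D₂.A D₁.Ψ D₂.Ψ
    (fun γ => by
      rw [extIn_glue2, extOut_glue2]
      simp only [glueDressing, restL_val, restR_val]
      ring)
    (fun ζ => rfl) (fun ξ => rfl)
  refine h.trans ?_
  refine Finset.sum_congr rfl fun p' _ => Finset.sum_congr rfl fun q' _ => ?_
  congr 1
  congr 1
  · refine D₁.legAmp_congr bS bV bO fun γ => ?_
    change (if γ ⟨sOut T₁, _⟩ = p' then (1 : ℝ) else 0) * ((if γ (extIn T₁) = p then (1 : ℝ) else 0) * D₁.F fun x => γ x.1) = _
    ring
  · refine D₂.legAmp_congr bS bV bO fun γ => ?_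
    change (if γ ⟨sIn T₂, _⟩ = q' then (1 : ℝ) else 0) * ((if γ (extOut T₂) = q then (1 : ℝ) else 0) * D₂.F fun y => γ y.1) = _
    ring

end Kernel

/-! ## §3 Chains: the kernel of `chain T l` is the matrix product of (1.21) -/

section Chain

variable {SF VF OF IS IV IO : Type*} [Fintype IS] [Fintype IV] [Fintype IO] [DecidableEq IS]
  (bS : IS → SF) (bV : IV → VF) (bO : IO → OF) (C : IS → IS → ℝ)

/-- A DRESSED insertion: a two-leg insertion with a dressing (a letter of a chain with its data). [cite: Balaban1983Higgs3, (1.21) p.416] -/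
abbrev Dressed (SF VF OF IS IV IO : Type*) (nbar : ℕ) : Type _ := Σ T : TwoLegGraph nbar, Dressing SF VF OF IS IV IO T

/-- **The dressing of the chain `chain T l`** glued from the dressings of its letters, every joining line carrying `C` (print: the
free propagators `C^ε_0` between consecutive insertions). [cite: Balaban1983Higgs3, (1.21) p.416] -/
def chainDressing : (T : TwoLegGraph nbar) → Dressing SF VF OF IS IV IO T → (l : List (Dressed SF VF OF IS IV IO nbar)) →
    Dressing SF VF OF IS IV IO (chain T (l.map Sigma.fst))
  | _, D, [] => D
  | T, D, ⟨T', D'⟩ :: l => glueDressing T (chain T' (l.map Sigma.fst)) D (chainDressing T' D' l) C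

omit [Fintype IS] [Fintype IV] [Fintype IO] [DecidableEq IS] in
/-- kernel: the dressing of a one-letter chain. [cite: Balaban1983Higgs3, (1.21) p.416] -/
@[simp] theorem chainDressing_nil (T : TwoLegGraph nbar) (D : Dressing SF VF OF IS IV IO T) :
    chainDressing C T D [] = D := rfl

omit [Fintype IS] [Fintype IV] [Fintype IO] [DecidableEq IS] in
/-- kernel: the dressing of a longer chain. [cite: Balaban1983Higgs3, (1.21) p.416] -/
theorem chainDressing_cons (T T' : TwoLegGraph nbar) (D : Dressing SF VF OF IS IV IO T) (D' : Dressing SF VF OF IS IV IO T')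
    (l : List (Dressed SF VF OF IS IV IO nbar)) :
    chainDressing C T D (⟨T', D'⟩ :: l) = glueDressing T (chain T' (l.map Sigma.fst)) D (chainDressing C T' D' l) C := rfl

/-- **The kernel of a chain of insertions is the matrix product `K_T · Π_i (C · K_{l_i})`** — the amputated value of the glued chain
GRAPH of p18's model is the product of (1.21) read without its two outer free propagators. [cite: Balaban1983Higgs3, (1.21) p.416] -/
theorem kernel_chain (T : TwoLegGraph nbar) (D : Dressing SF VF OF IS IV IO T) (l : List (Dressed SF VF OF IS IV IO nbar)) :
    (chainDressing C T D l).kernel bS bV bO =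
      D.kernel bS bV bO * (l.map fun TD => Matrix.of C * TD.2.kernel bS bV bO).prod := by
  induction l generalizing T D with
  | nil => simp
  | cons TD l ih =>
    obtain ⟨T', D'⟩ := TD
    rw [chainDressing_cons]
    erw [kernel_glue2]
    rw [ih]
    simp only [List.map_cons, List.prod_cons, Matrix.mul_assoc]

/-- kernel: re-associating the joining propagators from the left of each letter to its right. [folklore] -/
private theorem mul_prod_map_mul_eq {n : Type*} [Fintype n] [DecidableEq n] {κ : Type*} (M C₀ : Matrix n n ℝ)
    (K : κ → Matrix n n ℝ) (l : List κ) :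
    M * (l.map fun i => C₀ * K i).prod * C₀ = M * C₀ * (l.map fun i => K i * C₀).prod := by
  induction l generalizing M with
  | nil => simp
  | cons i l ih =>
    simp only [List.map_cons, List.prod_cons]
    calc M * (C₀ * K i * (l.map fun i => C₀ * K i).prod) * C₀
        = M * C₀ * K i * (l.map fun i => C₀ * K i).prod * C₀ := by simp only [Matrix.mul_assoc]
      _ = M * C₀ * K i * C₀ * (l.map fun i => K i * C₀).prod := ih _
      _ = M * C₀ * (K i * C₀ * (l.map fun i => K i * C₀).prod) := by simp only [Matrix.mul_assoc]

/-- **p32's `chainAmp` READ ON GRAPHS**: with the insertions indexed by the dressed two-leg graphs of p18's model, their values the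
amputated kernels and `C₀ = Matrix.of C`, the term of (1.21) indexed by the list `T, l₁, …, l_r` — `chainAmp C₀ kernel (⟨T,D⟩ :: l) =
C₀ · K_T · C₀ · K_{l₁} · C₀ ⋯ K_{l_r} · C₀` — IS `C₀ · K_{chain T l} · C₀`: the free propagator, the amputated kernel of the GLUED CHAIN
GRAPH `chain T l`, the free propagator (p32 gen 41's HONEST SCOPE (i) served on the model). [cite: Balaban1983Higgs3, (1.21) p.416] -/
theorem chainAmp_eq_kernel_chain (T : TwoLegGraph nbar) (D : Dressing SF VF OF IS IV IO T)
    (l : List (Dressed SF VF OF IS IV IO nbar)) :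
    B3Eq121OnePIChains.chainAmp (Matrix.of C) (fun TD : Dressed SF VF OF IS IV IO nbar => TD.2.kernel bS bV bO) (⟨T, D⟩ :: l) =
      Matrix.of C * (chainDressing C T D l).kernel bS bV bO * Matrix.of C := by
  have e := mul_prod_map_mul_eq (Matrix.of C * D.kernel bS bV bO) (Matrix.of C)
    (fun TD : Dressed SF VF OF IS IV IO nbar => TD.2.kernel bS bV bO) l
  rw [kernel_chain, B3Eq121OnePIChains.chainAmp, B3Eq121OnePIChains.insAmp, List.map_cons, List.prod_cons]
  simp only [Matrix.mul_assoc] at e ⊢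
  exact e.symm

/-- **The displayed case (1.22) p. 416: the reducible term ①—C₀^ε—① of order λ²** (p37's `chain (pic1 n̄) [pic1 n̄]`, the
(1.22)-① tadpole insertion glued twice): its amputated kernel is `K_① · C₀ · K_①` for any dressings of the two copies.
[cite: Balaban1983Higgs3, (1.22) p.416] -/
theorem kernel_chain_pic1_pic1 (D D' : Dressing SF VF OF IS IV IO (pic1 nbar)) :
    (chainDressing C (pic1 nbar) D [⟨pic1 nbar, D'⟩]).kernel bS bV bO =
      D.kernel bS bV bO * (Matrix.of C * D'.kernel bS bV bO) := by
  rw [kernel_chain, List.map_singleton, List.prod_singleton]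

end Chain

/-! ## §4 (1.21) for the chain graphs of the model: p32's transport theorem instantiated -/

section Series

variable {SF VF OF IS IV IO : Type*} [Fintype IS] [Fintype IV] [Fintype IO] [DecidableEq IS] {κ σ : Type*}
  (bS : IS → SF) (bV : IV → VF) (bO : IO → OF) (C : IS → IS → ℝ)
  (letter : κ → Dressed SF VF OF IS IV IO nbar) (deg : κ → σ →₀ ℕ)

omit [Fintype IS] [Fintype IV] [Fintype IO] [DecidableEq IS] in
/-- kernel: p32's chain value is natural in the indexing of the letters. [cite: Balaban1983Higgs3, (1.21) p.416] -/
theorem chainAmp_map {R : Type*} [Ring R] {ι ι' : Type*} (C0 : R) (amp : ι' → R) (f : ι → ι') (l : List ι) :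
    B3Eq121OnePIChains.chainAmp C0 (fun i => amp (f i)) l = B3Eq121OnePIChains.chainAmp C0 amp (l.map f) := by
  induction l with
  | nil => simp
  | cons i l ih => rw [List.map_cons, B3Eq121OnePIChains.chainAmp_cons, B3Eq121OnePIChains.chainAmp_cons, ih]

/-- The TERMS of (1.21) on the model, for a family `letter : κ → Dressed …` of dressed insertions (print: the 1PI graphs and the
`−δm²` vertices): the bare free propagator (`none`, the term `n = 0`) or the chain graph `chain (letter h) (t.map letter)` of a
non-empty list `h :: t` of letters. [cite: Balaban1983Higgs3, (1.21) p.416] -/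
def chainIndexEquiv (κ : Type*) : Option (κ × List κ) ≃ List κ where
  toFun g := match g with
    | none => []
    | some (h, t) => h :: t
  invFun l := match l with
    | [] => none
    | h :: t => some (h, t)
  left_inv g := by rcases g with _ | ⟨h, t⟩ <;> rfl
  right_inv l := by rcases l with _ | ⟨h, t⟩ <;> rfl

/-- The VALUE of a term of (1.21) on the model: `C₀` for the bare propagator, `C₀ · K_{chain} · C₀` for a chain graph — the free
propagators on the two external legs of the amputated kernel of the glued chain graph. [cite: Balaban1983Higgs3, (1.21) p.416] -/
noncomputable def chainValue : Option (κ × List κ) → Matrix IS IS ℝ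
  | none => Matrix.of C
  | some (h, t) => Matrix.of C * (chainDressing C (letter h).1 (letter h).2 (t.map letter)).kernel bS bV bO * Matrix.of C

/-- The ORDER of a term in the couplings: the sum of the orders of its letters. [cite: Balaban1983Higgs3, (1.21) p.416] -/
noncomputable def chainOrder : Option (κ × List κ) → σ →₀ ℕ
  | none => 0
  | some (h, t) => B3Eq121OnePIChains.chainDeg deg (h :: t)

/-- kernel: the value of a term is p32's chain value of its list of letters. [cite: Balaban1983Higgs3, (1.21) p.416] -/
theorem chainValue_eq_chainAmp (g : Option (κ × List κ)) :
    chainValue bS bV bO C letter g =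
      B3Eq121OnePIChains.chainAmp (Matrix.of C) (fun i => (letter i).2.kernel bS bV bO) (chainIndexEquiv κ g) := by
  rcases g with _ | ⟨h, t⟩
  · simp [chainValue, chainIndexEquiv]
  · change Matrix.of C * (chainDressing C (letter h).1 (letter h).2 (t.map letter)).kernel bS bV bO * Matrix.of C =
      B3Eq121OnePIChains.chainAmp (Matrix.of C) (fun i => (letter i).2.kernel bS bV bO) (h :: t)
    rw [chainAmp_map (Matrix.of C) (fun TD : Dressed SF VF OF IS IV IO nbar => TD.2.kernel bS bV bO) letter, List.map_cons,
      ← chainAmp_eq_kernel_chain]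

omit [Fintype IS] [Fintype IV] [Fintype IO] [DecidableEq IS] in
/-- kernel: the order of a term is p32's chain order of its list of letters. [cite: Balaban1983Higgs3, (1.21) p.416] -/
theorem chainOrder_eq_chainDeg (g : Option (κ × List κ)) :
    chainOrder deg g = B3Eq121OnePIChains.chainDeg deg (chainIndexEquiv κ g) := by
  rcases g with _ | ⟨h, t⟩
  · simp [chainOrder, chainIndexEquiv]
  · rfl

/-- **(1.21) FOR THE CHAIN GRAPHS OF THE MODEL, I**: the generating series `Σ_g e^{order g}·value g` over the terms of the model
(bare `C₀` ⊕ the chain graphs of the letters) IS p32's chain series `greenSeries C₀ (amputated kernels of the letters) deg` in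
`(Matrix IS IS ℝ)[[σ]]` — p32's `sigmaSeries_eq_greenSeries_of_equiv` with the bridge decomposition = (`chainIndexEquiv`, FILE K3's
`chainAmp_eq_kernel_chain`). [cite: Balaban1983Higgs3, (1.21) p.416] -/
theorem sigmaSeries_chainValue_eq_greenSeries :
    B3Eq121OnePIChains.sigmaSeries (chainValue bS bV bO C letter) (chainOrder deg) =
      B3Eq121OnePIChains.greenSeries (Matrix.of C) (fun i => (letter i).2.kernel bS bV bO) deg :=
  B3Eq121OnePIChainsLetters.sigmaSeries_eq_greenSeries_of_equiv _ _ _ _ _ (chainIndexEquiv κ)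
    (chainValue_eq_chainAmp bS bV bO C letter) (chainOrder_eq_chainDeg deg)

/-- **(1.21) FOR THE CHAIN GRAPHS OF THE MODEL, II**: if every letter has positive order and each order carries finitely many
letters (print: the 1PI graphs have at least one vertex; finitely many graphs per order), the series of the values of the chain
graphs satisfies r15's resummed (1.21) `Eq121 G (C C₀) X` with `X` = the series of the letters' AMPUTATED KERNELS — p32's
`eq121_sigmaSeries_of_equiv` on p18's model with p26's evaluator. [cite: Balaban1983Higgs3, (1.21) p.416] -/
theorem eq121_chainValue (hne : ∀ i, deg i ≠ 0) (hfin : ∀ d, {i | deg i = d}.Finite) :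
    B3Sect1TwoPoint.Eq121 (B3Eq121OnePIChains.sigmaSeries (chainValue bS bV bO C letter) (chainOrder deg))
      (MvPowerSeries.C (Matrix.of C)) (B3Eq121OnePIChains.sigmaSeries (fun i => (letter i).2.kernel bS bV bO) deg) :=
  B3Eq121OnePIChainsLetters.eq121_sigmaSeries_of_equiv _ _ _ _ _ (chainIndexEquiv κ)
    (chainValue_eq_chainAmp bS bV bO C letter) (chainOrder_eq_chainDeg deg) hne hfin

end Series

end Literature.MathematicalPhysics.QuantumFieldTheory.Balaban1983to89.B3OnePIChainAmplitude
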